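import Summits.QuantumFields.YangMills.Theorems.IsotropyFromPowerCountingTemperedCurvatureMomentsApproximantsTransfer
import Summits.QuantumFields.YangMills.Theorems.PencilRigidityCurvatureKernelBoundKernelOffDiagonal
import Summits.QuantumFields.YangMills.Theorems.PencilRigidityCurvatureKernelBoundChartDerivativeBounds
import Summits.QuantumFields.YangMills.Theorems.PencilRigidityCurvatureKernelBoundTensorRegularity
import Summits.QuantumFields.YangMills.Theorems.PencilRigidityCurvatureKernelBoundOffDiagonalExtension
import Summits.QuantumFields.YangMills.Theorems.MirrorModularBoostsCurvatureBoostCovarianceDominatedTieLimit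

/-!
# Degree two of `TemperedCurvatureMoments` is model-blind — stub `stub_degreeTwo`

Line `Sketch` (markov-shielding) of crux `IsotropyFromPowerCounting.TemperedCurvatureMoments`
(T, stmt-QuantumFields-17721), stub `stub_degreeTwo` of reshape 3 of the registered skeleton
`Cruxes/TemperedCurvatureMoments/Lines/Sketch.lean` (registered signature verbatim).

Statement.  For every one-species Schwinger family `S₁` on `ℝ⁴` with the OS package (`OSPackage`),
translation invariance on `⁰𝒮` (`Translations`), invariance under the proper signed permutations
(`Hypercubic`) and reflection positivity in the eight planar frames (`EightFrameRP`), whose two-point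
function is REAL on real off-diagonal tensors, and for every admissible pair `(a, L)` (`a_k > 0`,
`a_k → 0`, `a_k L_k → ∞`): `TemperedApproximants a L S₁ 2` (tempered tied lattice approximants of
`S₁ 2`).  No lattice, no gauge group, no tie beyond realness enters: degree two of T carries no
Yang–Mills content.

Proof (all ingredients landed).
1. *Kernel* (`DegreeTwoModelBlind.exists_kernel`): the four DIAGONAL frames `a² = b² = 1/2` of
   `EightFrameRP` are the extra input of the sixteen-mirror lever `CurvatureKernel.KernelOffDiagonal`
   (over the landed `ChartDerivativeBounds`, `TensorRegularity`) of crux 11687; with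
   `OffDiagonalExtension` it yields `K : ℝ⁴ → ℂ` continuous off `0` with a two-sided POLYNOMIAL bound
   `‖K x‖ ≤ A (‖x‖ᵖ + ‖x‖⁻ᵖ)` and `S₁ 2 F = ∫ K(x₀ - x₁) F(x) dx` (absolutely convergent) for all
   `F ∈ ⁰𝒮₂`.
2. *The kernel is a tempered pair weight* (`DegreeTwoModelBlind.norm_kernel_le_pairWeight`): off the
   diagonal `‖K(y₀ - y₁)‖ ≤ C (1 + ‖y‖)ᵖ (1 + Σᵢ Σ_{j≠i} ‖yᵢ - yⱼ‖⁻¹)ᵖ` with `C = |A| 2ᵖ + |A| + 1`,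
   from `‖y₀ - y₁‖ ≤ 2‖y‖` and `‖y₀ - y₁‖⁻¹ ≤ Σᵢ Σ_{j≠i} ‖yᵢ - yⱼ‖⁻¹`.
3. *Domination* (`DegreeTwoModelBlind.dominated_of_kernel`): for `F ∈ ⁰𝒮₂`, `‖F‖ w_{C,p} ∈ L¹`
   (flat decay of `⁰𝒮` functions against the pair weight, `DominatedTieLimit.norm_mul_weight_le`, and
   the Japanese-bracket majorant `DominatedTieLimit.integrable_piMajorant`) and
   `‖S₁ 2 F‖ ≤ ∫ ‖K(y₀ - y₁) F(y)‖ dy ≤ ∫ ‖F‖ w_{C,p}` (on the diagonal `F = 0`).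
4. *Conclusion*: the landed `temperedApproximants_of_dominated` (bump sampling, Steps 2–4 of
   `stub_approximantsTransfer`) with `n = 2`.

References: K. Osterwalder, R. Schrader, Comm. Math. Phys. 31 (1973) §2 and 42 (1975) §2 (`⁰𝒮`,
temperedness of lattice approximants); J. Glimm, A. Jaffe, Quantum Physics (1987) §6.1, §9.5–9.6
(lattice approximation, Riemann sums). [folklore]
-/

noncomputable section


namespace Summit.QuantumFields.YangMills.Theorems.TemperedCurvatureMoments.Sketch

open scoped BigOperators SchwartzMap
open MeasureTheory Filter Topology Set
open Literature.MathematicalPhysics.QuantumFieldTheory Literature.MathematicalPhysics.QuantumLattice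
open Literature.MathematicalPhysics.AQFT
open Summit.QuantumFields.YangMills.Theorems.NPointIsotropy.Negative (E4)
open Summit.QuantumFields.YangMills.Theorems.TemperedCurvatureMoments.Negative (TemperedApproximants)
open Summit.QuantumFields.YangMills.Theorems.CurvatureBoostCovariance.Negative
  (OSPackage Translations Hypercubic EightFrameRP)
open Summit.QuantumFields.YangMills.Theorems.CurvatureKernel
  (KernelOffDiagonal ChartDerivativeBounds TensorRegularity OffDiagonalExtension)
open Summit.QuantumFields.YangMills.Theorems.CurvatureBoostCovariance.BoostsInheritMirrors
  (DominatedTieLimit.norm_mul_weight_le DominatedTieLimit.integrable_piMajorant)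

namespace DegreeTwoModelBlind

/-! ## Step 1: the two-point kernel on `⁰𝒮₂` from the diagonal frames -/

/-- **The two-point kernel of an admissible family.**  A one-species family `S₁` on `ℝ⁴` with the OS
package, translations and proper signed permutations on `⁰𝒮` and reflection positivity in the eight
planar frames has a kernel `K : ℝ⁴ → ℂ`, continuous off `0`, with `‖K x‖ ≤ A (‖x‖ᵖ + ‖x‖⁻ᵖ)` for
`x ≠ 0`, representing `S₁ 2` on ALL of `⁰𝒮₂`: `S₁ 2 F = ∫ K(x₀ - x₁) F(x) dx` with integrable
integrand.  (The four diagonal frames `a² = b² = 1/2` of `EightFrameRP` feed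
`CurvatureKernel.KernelOffDiagonal` over `ChartDerivativeBounds` / `TensorRegularity`; then
`OffDiagonalExtension`.) [folklore] -/
theorem exists_kernel (S₁ : SchwingerFamily E4) (hpkg : OSPackage S₁) (htr : Translations S₁)
    (hhyp : Hypercubic S₁) (h8 : EightFrameRP S₁) :
    ∃ K : E4 → ℂ, ContinuousOn K {x : E4 | x ≠ 0} ∧
      (∃ (A : ℝ) (p : ℕ), ∀ x : E4, x ≠ 0 → ‖K x‖ ≤ A * (‖x‖ ^ p + ‖x‖⁻¹ ^ p)) ∧
      ∀ F : 𝓢((Fin 2 → E4), ℂ), IsOffDiagonal F →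
        Integrable (fun x : Fin 2 → E4 => K (x 0 - x 1) * F x) ∧
          S₁ 2 F = ∫ x : Fin 2 → E4, K (x 0 - x 1) * F x := by
  -- the four diagonal frames among the eight planar ones
  have hdiag : ∀ (R : E4 ≃ₗᵢ[ℝ] E4) (a b : ℝ), a ^ 2 = 1 / 2 → b ^ 2 = 1 / 2 →
      R (EuclideanSpace.single 0 1) = a • EuclideanSpace.single 0 1 + b • EuclideanSpace.single 1 1 →
      (SchwingerFamily.toLabelled (fun n => (S₁ n).comp (linActMulti R))).IsReflectionPositive :=
    fun R a b ha hb hR => h8 R a b (by rw [ha, hb]; norm_num) (Or.inr (Or.inr (by rw [ha, hb]))) hR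
  obtain ⟨K, hcont, hbd, hrep⟩ :=
    KernelOffDiagonal ChartDerivativeBounds TensorRegularity S₁ hpkg htr hhyp hdiag
  exact ⟨K, hcont, hbd, OffDiagonalExtension (S₁ 2) K hcont hbd hrep⟩

/-! ## Step 2: a two-sided polynomially bounded kernel is a tempered pair weight -/

/-- **The kernel against T's pair weight.**  If `‖K x‖ ≤ A (‖x‖ᵖ + ‖x‖⁻ᵖ)` for `x ≠ 0`, then off the
diagonal `‖K(y₀ - y₁)‖ ≤ (|A| 2ᵖ + |A| + 1) (1 + ‖y‖)ᵖ (1 + Σᵢ Σ_{j≠i} ‖yᵢ - yⱼ‖⁻¹)ᵖ`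
(`‖y₀ - y₁‖ ≤ ‖y₀‖ + ‖y₁‖ ≤ 2‖y‖` controls the growth, `‖y₀ - y₁‖⁻¹ ≤ Σᵢ Σ_{j≠i} ‖yᵢ - yⱼ‖⁻¹` the
singularity). [folklore] -/
theorem norm_kernel_le_pairWeight (K : E4 → ℂ) {A : ℝ} {p : ℕ}
    (hAp : ∀ x : E4, x ≠ 0 → ‖K x‖ ≤ A * (‖x‖ ^ p + ‖x‖⁻¹ ^ p)) (y : Fin 2 → E4) (hy : y 0 ≠ y 1) :
    ‖K (y 0 - y 1)‖ ≤ (|A| * 2 ^ p + |A| + 1) * (1 + ‖y‖) ^ p *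
      (1 + ∑ i, ∑ j ∈ Finset.univ.erase i, ‖y i - y j‖⁻¹) ^ p := by
  have hw0 : y 0 - y 1 ≠ 0 := sub_ne_zero.2 hy
  have hr : 0 < ‖y 0 - y 1‖ := norm_pos_iff.2 hw0
  have hA := hAp (y 0 - y 1) hw0
  -- growth at infinity: `‖y₀ - y₁‖ ≤ 2 (1 + ‖y‖)`
  -- adapted from `DegreeTwo.kernel_tempered` (…TemperedCurvatureMomentsDegreeTwoOfKernel)
  have hwy : ‖y 0 - y 1‖ ≤ 2 * (1 + ‖y‖) := by
    calc ‖y 0 - y 1‖ ≤ ‖y 0‖ + ‖y 1‖ := norm_sub_le _ _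
      _ ≤ ‖y‖ + ‖y‖ := add_le_add (norm_le_pi_norm y 0) (norm_le_pi_norm y 1)
      _ ≤ 2 * (1 + ‖y‖) := by linarith [norm_nonneg y]
  have h1 : ‖y 0 - y 1‖ ^ p ≤ 2 ^ p * (1 + ‖y‖) ^ p := by
    rw [← mul_pow]; exact pow_le_pow_left₀ hr.le hwy p
  -- the singularity: `‖y₀ - y₁‖⁻¹ ≤ Σᵢ Σ_{j≠i} ‖yᵢ - yⱼ‖⁻¹`
  -- adapted from `DegreeTwo.temperedCurvatureMoments_two_of_kernel`
  -- (…TemperedCurvatureMomentsDegreeTwoOfKernel)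
  have hσ0 : 0 ≤ ∑ i, ∑ j ∈ Finset.univ.erase i, ‖y i - y j‖⁻¹ :=
    Finset.sum_nonneg fun i _ => Finset.sum_nonneg fun j _ => inv_nonneg.2 (norm_nonneg _)
  have hinv : ‖y 0 - y 1‖⁻¹ ≤ ∑ i, ∑ j ∈ Finset.univ.erase i, ‖y i - y j‖⁻¹ := by
    have h3 : ‖y 0 - y 1‖⁻¹ ≤ ∑ j ∈ Finset.univ.erase (0 : Fin 2), ‖y 0 - y j‖⁻¹ :=
      Finset.single_le_sum (f := fun j => ‖y 0 - y j‖⁻¹) (fun j _ => inv_nonneg.2 (norm_nonneg _))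
        (Finset.mem_erase.2 ⟨by decide, Finset.mem_univ 1⟩)
    have h4 : ∑ j ∈ Finset.univ.erase (0 : Fin 2), ‖y 0 - y j‖⁻¹ ≤
        ∑ i, ∑ j ∈ Finset.univ.erase i, ‖y i - y j‖⁻¹ :=
      Finset.single_le_sum (f := fun i => ∑ j ∈ Finset.univ.erase i, ‖y i - y j‖⁻¹)
        (fun i _ => Finset.sum_nonneg fun j _ => inv_nonneg.2 (norm_nonneg _)) (Finset.mem_univ 0)
    exact h3.trans h4
  have h2 : ‖y 0 - y 1‖⁻¹ ^ p ≤ (1 + ∑ i, ∑ j ∈ Finset.univ.erase i, ‖y i - y j‖⁻¹) ^ p :=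
    pow_le_pow_left₀ (inv_nonneg.2 hr.le) (by linarith) p
  -- both factors of the weight are `≥ 1`
  have hYp : 1 ≤ (1 + ‖y‖) ^ p := one_le_pow₀ (le_add_of_nonneg_right (norm_nonneg _))
  have hSp : 1 ≤ (1 + ∑ i, ∑ j ∈ Finset.univ.erase i, ‖y i - y j‖⁻¹) ^ p :=
    one_le_pow₀ (le_add_of_nonneg_right hσ0)
  have hYS : 0 ≤ (1 + ‖y‖) ^ p * (1 + ∑ i, ∑ j ∈ Finset.univ.erase i, ‖y i - y j‖⁻¹) ^ p :=
    mul_nonneg (zero_le_one.trans hYp) (zero_le_one.trans hSp)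
  calc ‖K (y 0 - y 1)‖ ≤ A * (‖y 0 - y 1‖ ^ p + ‖y 0 - y 1‖⁻¹ ^ p) := hA
    _ ≤ |A| * (‖y 0 - y 1‖ ^ p + ‖y 0 - y 1‖⁻¹ ^ p) :=
        mul_le_mul_of_nonneg_right (le_abs_self A)
          (add_nonneg (pow_nonneg hr.le p) (pow_nonneg (inv_nonneg.2 hr.le) p))
    _ ≤ |A| * (2 ^ p * (1 + ‖y‖) ^ p + (1 + ∑ i, ∑ j ∈ Finset.univ.erase i, ‖y i - y j‖⁻¹) ^ p) :=
        mul_le_mul_of_nonneg_left (add_le_add h1 h2) (abs_nonneg A)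
    _ ≤ |A| * (2 ^ p * (1 + ‖y‖) ^ p * (1 + ∑ i, ∑ j ∈ Finset.univ.erase i, ‖y i - y j‖⁻¹) ^ p +
          (1 + ‖y‖) ^ p * (1 + ∑ i, ∑ j ∈ Finset.univ.erase i, ‖y i - y j‖⁻¹) ^ p) := by
        refine mul_le_mul_of_nonneg_left (add_le_add ?_ ?_) (abs_nonneg A)
        · exact le_mul_of_one_le_right
            (mul_nonneg (pow_nonneg zero_le_two p) (zero_le_one.trans hYp)) hSp
        · exact le_mul_of_one_le_left (zero_le_one.trans hSp) hYp
    _ = (|A| * 2 ^ p + |A|) * ((1 + ‖y‖) ^ p *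
          (1 + ∑ i, ∑ j ∈ Finset.univ.erase i, ‖y i - y j‖⁻¹) ^ p) := by ring
    _ ≤ (|A| * 2 ^ p + |A| + 1) * ((1 + ‖y‖) ^ p *
          (1 + ∑ i, ∑ j ∈ Finset.univ.erase i, ‖y i - y j‖⁻¹) ^ p) :=
        mul_le_mul_of_nonneg_right (le_add_of_nonneg_right zero_le_one) hYS
    _ = (|A| * 2 ^ p + |A| + 1) * (1 + ‖y‖) ^ p *
          (1 + ∑ i, ∑ j ∈ Finset.univ.erase i, ‖y i - y j‖⁻¹) ^ p := by ring

/-! ## Step 3: domination of `S₁ 2` by T's pair weight -/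

/-- **`⁰𝒮` functions are integrable against T's pair weight.**  For `F ∈ ⁰𝒮((ℝ⁴)ⁿ)`, `C > 0` and
`N : ℕ`, `y ↦ ‖F y‖ · C (1 + ‖y‖)^N (1 + Σᵢ Σ_{j≠i} ‖yᵢ - yⱼ‖⁻¹)^N` is Lebesgue integrable: by the
flat decay of `⁰𝒮` functions against the pair weight (`DominatedTieLimit.norm_mul_weight_le`) it is
`O((1 + ‖y‖)^{-(4n+1)})`, an integrable Japanese bracket on `(ℝ⁴)ⁿ`
(`DominatedTieLimit.integrable_piMajorant`). [folklore] -/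
theorem integrable_norm_mul_pairWeight {n : ℕ} {C : ℝ} (hC : 0 < C) (N : ℕ)
    {F : 𝓢((Fin n → E4), ℂ)} (hF : IsOffDiagonal F) :
    Integrable (fun y : Fin n → E4 => ‖F y‖ * (C * (1 + ‖y‖) ^ N *
      (1 + ∑ i, ∑ j ∈ Finset.univ.erase i, ‖y i - y j‖⁻¹) ^ N)) := by
  obtain ⟨hwm, -, hw0⟩ := ApproximantsTransfer.weight_measurable_continuousOn_nonneg n hC N
  have hmaj : ∀ y : Fin n → E4, ‖F y‖ * (C * (1 + ‖y‖) ^ N *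
      (1 + ∑ i, ∑ j ∈ Finset.univ.erase i, ‖y i - y j‖⁻¹) ^ N) ≤
      |C| * 4 ^ (N + (4 * n + 1)) * (1 + (n : ℝ) ^ 2) ^ N *
        (Finset.Iic (N + (4 * n + 1), N + 1)).sup (schwartzSeminormFamily ℂ (Fin n → E4) ℂ) F *
          ((1 + ‖y‖) ^ (4 * n + 1))⁻¹ := fun y =>
    DominatedTieLimit.norm_mul_weight_le hF
      (w := fun y : Fin n → E4 => C * (1 + ‖y‖) ^ N *
        (1 + ∑ i, ∑ j ∈ Finset.univ.erase i, ‖y i - y j‖⁻¹) ^ N)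
      (fun y _ => le_rfl) (4 * n + 1) y
  refine (DominatedTieLimit.integrable_piMajorant (n := n) (p := 4 * n + 1) (by omega)
    (|C| * 4 ^ (N + (4 * n + 1)) * (1 + (n : ℝ) ^ 2) ^ N *
      (Finset.Iic (N + (4 * n + 1), N + 1)).sup (schwartzSeminormFamily ℂ (Fin n → E4) ℂ) F)).mono'
    (F.continuous.norm.measurable.mul hwm).aestronglyMeasurable (ae_of_all _ fun y => ?_)
  rw [Real.norm_of_nonneg (mul_nonneg (norm_nonneg _) (hw0 y))]
  exact hmaj y

/-- **Domination of a kernel functional by T's pair weight.**  If `T F = ∫ K(x₀ - x₁) F(x) dx`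
(absolutely convergent) on `⁰𝒮₂` with `‖K x‖ ≤ A (‖x‖ᵖ + ‖x‖⁻ᵖ)` off `0`, then for every `F ∈ ⁰𝒮₂`
the function `‖F‖ w_{C,p}`, `C = |A| 2ᵖ + |A| + 1`, is integrable and `‖T F‖ ≤ ∫ ‖F‖ w_{C,p}`
(`‖∫ K F‖ ≤ ∫ ‖K F‖`, then pointwise: `norm_kernel_le_pairWeight` off the diagonal, `F = 0` on it).
[folklore] -/
theorem dominated_of_kernel (T : 𝓢((Fin 2 → E4), ℂ) →L[ℂ] ℂ) (K : E4 → ℂ) {A : ℝ} {p : ℕ}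
    (hAp : ∀ x : E4, x ≠ 0 → ‖K x‖ ≤ A * (‖x‖ ^ p + ‖x‖⁻¹ ^ p))
    (hrep : ∀ F : 𝓢((Fin 2 → E4), ℂ), IsOffDiagonal F →
      Integrable (fun x : Fin 2 → E4 => K (x 0 - x 1) * F x) ∧
        T F = ∫ x : Fin 2 → E4, K (x 0 - x 1) * F x)
    (F : 𝓢((Fin 2 → E4), ℂ)) (hF : IsOffDiagonal F) :
    Integrable (fun y : Fin 2 → E4 => ‖F y‖ * ((|A| * 2 ^ p + |A| + 1) * (1 + ‖y‖) ^ p *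
        (1 + ∑ i, ∑ j ∈ Finset.univ.erase i, ‖y i - y j‖⁻¹) ^ p)) ∧
      ‖T F‖ ≤ ∫ y : Fin 2 → E4, ‖F y‖ * ((|A| * 2 ^ p + |A| + 1) * (1 + ‖y‖) ^ p *
        (1 + ∑ i, ∑ j ∈ Finset.univ.erase i, ‖y i - y j‖⁻¹) ^ p) := by
  have hC : 0 < |A| * 2 ^ p + |A| + 1 := by positivity
  have hint := integrable_norm_mul_pairWeight hC p hF
  refine ⟨hint, ?_⟩
  obtain ⟨hKF, hTF⟩ := hrep F hF
  rw [hTF]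
  refine (norm_integral_le_integral_norm _).trans (integral_mono hKF.norm hint fun y => ?_)
  show ‖K (y 0 - y 1) * F y‖ ≤ ‖F y‖ * ((|A| * 2 ^ p + |A| + 1) * (1 + ‖y‖) ^ p *
    (1 + ∑ i, ∑ j ∈ Finset.univ.erase i, ‖y i - y j‖⁻¹) ^ p)
  by_cases hy : y 0 = y 1
  · -- on the diagonal the test function vanishes
    have hmem : y ∈ coincidenceLocus 2 E4 := ⟨0, 1, by decide, hy⟩
    have h0 : F y = 0 := hF.apply_eq_zero hmem
    simp only [h0, mul_zero, norm_zero, zero_mul, le_refl]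
  · rw [norm_mul, mul_comm]
    exact mul_le_mul_of_nonneg_left (norm_kernel_le_pairWeight K hAp y hy) (norm_nonneg _)

end DegreeTwoModelBlind

/-! ## The stub -/

/-- **Stub `stub_degreeTwo` — degree 2 of T is model-blind** (registered signature of reshape 3 of the
skeleton `Cruxes/TemperedCurvatureMoments/Lines/Sketch.lean`, verbatim).  For every one-species family
`S₁` on `ℝ⁴` with the OS package, translation and proper-signed-permutation invariance on `⁰𝒮`,
reflection positivity in the eight planar frames, and REAL two-point values on real off-diagonal
tensors, and for every admissible `(a, L)` (`a_k → 0⁺`, `a_k L_k → ∞`): `TemperedApproximants a L S₁ 2`.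
Route: `DegreeTwoModelBlind.exists_kernel` (sixteen-mirror lever of crux 11687 + off-diagonal
extension) ⇒ `DegreeTwoModelBlind.dominated_of_kernel` (domination by `w_{C,p}`,
`C = |A| 2ᵖ + |A| + 1`) ⇒ `temperedApproximants_of_dominated`. [folklore] -/
theorem stub_degreeTwo :
    ∀ (S₁ : SchwingerFamily E4), OSPackage S₁ → Translations S₁ → Hypercubic S₁ → EightFrameRP S₁ →
      (∀ (f : Fin 2 → 𝓢(E4, ℝ)) (F : 𝓢((Fin 2 → E4), ℂ)),
        IsTensorOf F (fun i => ofRealTest (f i)) → IsOffDiagonal F → (S₁ 2 F).im = 0) →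
      ∀ (a : ℕ → ℝ) (L : ℕ → ℕ), (∀ k, 0 < a k) → Tendsto a atTop (𝓝 0) →
        Tendsto (fun k => a k * L k) atTop atTop → TemperedApproximants a L S₁ 2 := by
  intro S₁ hpkg htr hhyp h8 hreal a L ha ha0 haL
  obtain ⟨K, -, ⟨A, p, hAp⟩, hrep⟩ := DegreeTwoModelBlind.exists_kernel S₁ hpkg htr hhyp h8
  have hC : 0 < |A| * 2 ^ p + |A| + 1 := by positivity
  exact temperedApproximants_of_dominated two_pos S₁ hC
    (fun F hF => DegreeTwoModelBlind.dominated_of_kernel (S₁ 2) K hAp hrep F hF) hreal ha ha0 haL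

end Summit.QuantumFields.YangMills.Theorems.TemperedCurvatureMoments.Sketch

end
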